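import Mathlib

/-!
# Venture HSemireg — (S5) OBSTRUCTION LOCUS away from secant type, I: the follow-graph lemma (PROPOSITION G2-ARR)
# and the localisation theorem at the reducible point, with its NAMED hypotheses

HONEST FRAMING.  Part of the Lean side of the computation cell `pub-hsemireg` (track «S4-PUSH» (ii), seat s4-prove-2):
STRUCTURE.md v1.0 §2 **(S5)** = the COMPLEMENT of the K-isotypic saturation law — «away from secant type the
obstruction is LOCALISED in named pieces with closed-form dimension for all n» — typed and PROVED as far as it is
finite-dimensional linear algebra / combinatorics, with the geometric identifications entering ONLY as named
hypotheses.  Nothing here constructs a variety, a sheaf, a semiregularity map or an obstruction class; nothing here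
says that HC / HC_CM / HC_AV holds; no Literature fact is declared or used; every theorem is over an arbitrary field.

THE MODEL (G2-REDUCIBLE-POINT-THEOREM.md §1/§3, gs-eng-1 g2; G2-DEFORM-SANITY.md §B.4/§C, deform-ring2; both ×2 on
paper, engine-checked n ≤ 8).  At the reducible CM point `X = E₁ × ⋯ × Eₙ` with its product principal polarisation
`b`, `H¹(X, T_X) = H¹(X, 𝒪) ⊗ T₀X` has the basis `θ_kl = [dz̄_k] ⊗ ∂_l`; a direction is its coefficient matrix
`ξ ∈ Matrix (Fin n) (Fin n) K` (`Dir K n`).  The principally-polarised («pp») directions are the SYMMETRIC `ξ`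
(`ξ ⌟ b = Σ_{k<m} (ξ_km − ξ_mk) dz̄_k ∧ dz̄_m = 0`), spanned by the `n` factor directions `θ_aa` and the `C(n,2)` mixed
ones `θ_ab + θ_ba` (`ppDir a b`).  KODAIRA: the translate `B_S = {x_l = const : l ∈ S}` of a coordinate sub-torus
follows `ξ` to first order iff its Kodaira class in `H¹(B_S, N_{B_S}) = ⟨dz̄_k|_B : k ∉ S⟩ ⊗ ⟨∂_l : l ∈ S⟩` vanishes,
i.e. iff `ξ_kl = 0` for all `k ∉ S`, `l ∈ S` (`Follows S ξ`).  Hence (`follows_ppDir_iff`) `B_S` follows `θ_ab + θ_ba`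
iff `S` does NOT separate `a` from `b` (`|S ∩ {a,b}| ≠ 1`).  The `G`-INVARIANT mixed pp directions form a graph `𝒢_G`
on `[n]`: `K_n` for `G ⊂` translations `⋊ ⟨ι⟩` (`fullGraph`), `K_{P,P̄}` once `J = η_P(u)` is adjoined (`weilGraph P`,
whose edges are exactly the pairs `P` separates — the tangent directions of the Weil-type family of signature
`(|P|, n − |P|)`, `card_edgeFinset_weilGraph`: `|P|(n − |P|)` of them).

PROVED HERE (kernel, all `n`):
* `eq_empty_or_eq_univ_of_connected` — **PROPOSITION G2-ARR (combinatorial core)**: if `𝒢` is connected and `S`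
  separates no edge of `𝒢` then `S = ∅` or `S = [n]`; `fullGraph_connected` (`n ≥ 1`), `weilGraph_connected`
  (`P, P̄ ≠ ∅`), `card_edgeFinset_fullGraph = C(n,2)`, `card_edgeFinset_weilGraph = |P|(n−|P|)`.
* `ReduciblePointObject.types_trivial_of_semiregular` — **(S5) AT THE REDUCIBLE POINT**: for an object `F` governed by
  an arrangement of coordinate types `S_c` (hypothesis **(H-arr)**: `ob_F(ξ) = 0 ⇒` every `B_{S_c}` follows `ξ`) and
  `G`-semiregular in any sense that forces `ob_F = 0` along the `G`-invariant pp directions (hypothesis **(H-NC)**: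
  Buchweitz–Flenner `σ ∘ ob = ⌟ch` + `ξ ⌟ ch(F) = 0` for pp `ξ`), connectedness of `𝒢_G` forces every `S_c ∈ {∅, [n]}`;
  contrapositive `not_semiregular_of_pair_type`: NO SR-type design (a type of size 2, `n ≥ 3`) is `G`-semiregular, for
  any `d`, any CM type, any `G` of record — the CM type only selects WHICH connected graph is used.
The closed-form DIMENSIONS of the obstruction piece (rank `C(n,2)` on pp directions, kernel = the `n` factor
directions, `h¹(N′_W) = n(n−1)(n−2)`, full rank `n(n−1)`) are `ObstructionLocusKodaira.lean`; the torus-arrangement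
«uniform lemma form» (INJ `n²`, pair KER 1, CRITERION A) is `ObstructionLocusTorus.lean`; the twist lemma and the
Jacobian / Porteous companions are `ObstructionLocusCompanions.lean`.

WHAT IS HYPOTHESIS, NOT THEOREM (named, never discharged here): (H-arr) = Lemma L1 (`N′_W = ⊕_F ν_* N_{B_F}`, the
connecting map `N′ → 𝓔xt¹(I,I)` an isomorphism; two written proofs, four codes) + Prop. K (Kodaira / Hartshorne DT
Thm 2.4) + depth, and for `F′ / ⊠ / Φ`-images eng1 (R2)–(R4) with Toda 2009 Thm 1.1/4.7; (H-NC) = (S1) `σ∘ob = ±⌟ch`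
[Buchweitz–Flenner 2003 §4; 2008 Prop. 6.4.4] + (S2) `ch(F) ∈ ℚ[b]` killed by every pp direction + `G` acting
trivially on `𝒢_G`.  A refutation of either flips the geometric reading, not the kernel theorems.
References (dictionary only): Kodaira 1962 (stability of compact submanifolds); Hartshorne, Deformation Theory, Thm 2.4
/ 6.2; Altmann–Christophersen 2004/2010 (T¹ of Stanley–Reisner schemes — nearest prior art for L1); Buchweitz–Flenner
2003; Toda 2009; cell files G2-REDUCIBLE-POINT-THEOREM.md 33fa34ed1ce6a619, G2-DEFORM-SANITY.md §C, STRUCTURE.md §2 (S5)/(S-B).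
-/

open scoped BigOperators
open Finset

namespace Summit.Ventures.HSemireg.ObstructionLocus

variable (K : Type*) [Field K] (n : ℕ)

/-- Directions: coefficient matrices `ξ = Σ ξ_kl θ_kl` of `H¹(X, T_X) = H¹(X, 𝒪) ⊗ T₀X` at `X = E₁ × ⋯ × Eₙ`,
`θ_kl := [dz̄_k] ⊗ ∂_l`. -/
abbrev Dir : Type _ := Matrix (Fin n) (Fin n) K

variable {K n}

/-- The basis direction `θ_kl = [dz̄_k] ⊗ ∂_l`. -/
def theta (k l : Fin n) : Dir K n := Matrix.single k l 1

/-- The mixed principally-polarised direction `ξ_ab := θ_ab + θ_ba` (it smooths the product structure). -/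
def ppDir (a b : Fin n) : Dir K n := theta a b + theta b a

/-- KODAIRA branch criterion (model): the translate `B_S = {x_l = const : l ∈ S}` of a coordinate sub-torus follows `ξ`
to first order iff `ξ_kl = 0` for all `k ∉ S`, `l ∈ S` (its Kodaira class in
`H¹(B_S, N_{B_S}) = ⟨dz̄_k|_B : k ∉ S⟩ ⊗ ⟨∂_l : l ∈ S⟩` vanishes).  A predicate of the finite model, not a fact. -/
def Follows (S : Finset (Fin n)) (ξ : Dir K n) : Prop := ∀ k, k ∉ S → ∀ l, l ∈ S → ξ k l = 0

/-- `S` separates `a` from `b`: `|S ∩ {a, b}| = 1`.  A predicate of the finite model, not a fact. -/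
def Separates (S : Finset (Fin n)) (a b : Fin n) : Prop := (a ∈ S ∧ b ∉ S) ∨ (a ∉ S ∧ b ∈ S)

/-- Separation is decidable. -/
instance (S : Finset (Fin n)) (a b : Fin n) : Decidable (Separates S a b) :=
  inferInstanceAs (Decidable ((a ∈ S ∧ b ∉ S) ∨ (a ∉ S ∧ b ∈ S)))

/-- Separation is symmetric in the two points. -/
theorem separates_comm (S : Finset (Fin n)) (a b : Fin n) : Separates S a b ↔ Separates S b a := by
  unfold Separates; tauto

/-- Nothing separates a point from itself. -/
theorem not_separates_self (S : Finset (Fin n)) (a : Fin n) : ¬ Separates S a a := by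
  unfold Separates; tauto

/-- Entries of `θ_ab + θ_ba`. -/
theorem ppDir_apply (a b k l : Fin n) :
    (ppDir a b : Dir K n) k l = (if a = k ∧ b = l then 1 else 0) + (if b = k ∧ a = l then 1 else 0) := by
  simp [ppDir, theta, Matrix.add_apply, Matrix.single_apply]

/-- **Non-separation lemma** (G2-DEFORM-SANITY C.2). For `a ≠ b`, the branch `B_S` follows the mixed pp direction
`θ_ab + θ_ba` iff `S` does not separate `a` from `b`. -/
theorem follows_ppDir_iff {a b : Fin n} (hab : a ≠ b) (S : Finset (Fin n)) :
    Follows S (ppDir a b : Dir K n) ↔ ¬ Separates S a b := by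
  constructor
  · intro h hsep
    rcases hsep with ⟨ha, hb⟩ | ⟨ha, hb⟩
    · have := h b hb a ha
      rw [ppDir_apply] at this
      simp [hab] at this
    · have := h a ha b hb
      rw [ppDir_apply] at this
      simp [hab, Ne.symm hab] at this
  · intro h k hk l hl
    rw [ppDir_apply]
    have h1 : ¬ (a = k ∧ b = l) := by
      rintro ⟨rfl, rfl⟩; exact h (Or.inr ⟨hk, hl⟩)
    have h2 : ¬ (b = k ∧ a = l) := by
      rintro ⟨rfl, rfl⟩; exact h (Or.inl ⟨hl, hk⟩)
    simp [h1, h2]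

/-- The diagonal («factor») direction `θ_aa` is followed by every branch. -/
theorem follows_theta_self (S : Finset (Fin n)) (a : Fin n) : Follows S (theta a a : Dir K n) := by
  intro k hk l hl
  have : ¬ (a = k ∧ a = l) := by rintro ⟨rfl, rfl⟩; exact hk hl
  simp [theta, this]

/-! ## PROPOSITION G2-ARR: the follow-graph lemma -/

/-- Membership in `S` propagates along every walk of a graph none of whose edges `S` separates. -/
theorem mem_of_walk {G : SimpleGraph (Fin n)} {S : Finset (Fin n)}
    (h : ∀ a b, G.Adj a b → ¬ Separates S a b) :
    ∀ {u v : Fin n} (_ : G.Walk u v), u ∈ S → v ∈ S := by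
  intro u v p
  induction p with
  | nil => exact id
  | cons hadj _ ih =>
      intro hu
      apply ih
      by_contra hv
      exact h _ _ hadj (Or.inl ⟨hu, hv⟩)

/-- **PROPOSITION G2-ARR (combinatorial core).** If `G` is connected and `S` separates no edge of `G`, then `S = ∅` or
`S = univ`: a governing component that follows every `G`-invariant mixed pp direction is the whole of `X` (`S = ∅`)
or a point (`S = [n]`). -/
theorem eq_empty_or_eq_univ_of_connected {G : SimpleGraph (Fin n)} (hG : G.Connected) {S : Finset (Fin n)}
    (h : ∀ a b, G.Adj a b → ¬ Separates S a b) : S = ∅ ∨ S = Finset.univ := by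
  rcases S.eq_empty_or_nonempty with hS | ⟨a, ha⟩
  · exact Or.inl hS
  · refine Or.inr (Finset.eq_univ_iff_forall.2 fun b => ?_)
    obtain ⟨p⟩ := hG.preconnected a b
    exact mem_of_walk h p ha

/-- The same, phrased with `Follows`: if `B_S` follows `θ_ab + θ_ba` for every edge `{a,b}` of a connected graph, then
`S = ∅` or `S = univ`. -/
theorem eq_empty_or_eq_univ_of_follows {G : SimpleGraph (Fin n)} (hG : G.Connected) {S : Finset (Fin n)}
    (h : ∀ a b, G.Adj a b → Follows S (ppDir a b : Dir K n)) : S = ∅ ∨ S = Finset.univ :=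
  eq_empty_or_eq_univ_of_connected hG fun a b hab =>
    (follows_ppDir_iff (K := K) (G.ne_of_adj hab) S).1 (h a b hab)

/-! ## The two invariant-pair graphs of record -/

/-- `𝒢_G = K_n`: every mixed pp direction is invariant (`G ⊂` translations `⋊ ⟨ι⟩`). -/
abbrev fullGraph (n : ℕ) : SimpleGraph (Fin n) := ⊤

/-- `K_n` is connected for `n ≥ 1`. -/
theorem fullGraph_connected (hn : 1 ≤ n) : (fullGraph n).Connected := by
  haveI : Nonempty (Fin n) := ⟨⟨0, hn⟩⟩
  exact SimpleGraph.connected_top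

/-- Edge count of `K_n`: `C(n,2)` = the number of mixed pp directions = the rank of the Kodaira obstruction map on pp
directions (`ObstructionLocusKodaira`). -/
theorem card_edgeFinset_fullGraph : (fullGraph n).edgeFinset.card = n.choose 2 := by
  rw [SimpleGraph.card_edgeFinset_top_eq_card_choose_two, Fintype.card_fin]

/-- `𝒢_G = K_{P,P̄}`: with `J = η_P(u)` adjoined, `θ_ab + θ_ba` is `G`-invariant iff `P` separates `a` from `b`
(G2-DEFORM-SANITY B.4: the tangent directions of the Weil-type family of signature `(|P|, n − |P|)`). -/
def weilGraph (P : Finset (Fin n)) : SimpleGraph (Fin n) where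
  Adj a b := Separates P a b
  symm := ⟨fun a b h => (separates_comm P a b).1 h⟩
  loopless := ⟨fun a h => not_separates_self P a h⟩

/-- Adjacency in `K_{P,P̄}` is decidable. -/
instance (P : Finset (Fin n)) : DecidableRel (weilGraph P).Adj :=
  fun a b => inferInstanceAs (Decidable (Separates P a b))

/-- Adjacency in `K_{P,P̄}` is separation by `P`. -/
theorem weilGraph_adj (P : Finset (Fin n)) (a b : Fin n) : (weilGraph P).Adj a b ↔ Separates P a b := Iff.rfl

/-- `K_{P,P̄}` is connected as soon as both parts are non-empty (so adjoining `J` «cannot help»). -/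
theorem weilGraph_connected {P : Finset (Fin n)} (hP : P.Nonempty) (hP' : Pᶜ.Nonempty) :
    (weilGraph P).Connected := by
  obtain ⟨p, hp⟩ := hP
  obtain ⟨q, hq⟩ := hP'
  rw [Finset.mem_compl] at hq
  haveI : Nonempty (Fin n) := ⟨p⟩
  have hpq : (weilGraph P).Adj p q := Or.inl ⟨hp, hq⟩
  have key : ∀ a, (weilGraph P).Reachable a p := by
    intro a
    by_cases ha : a ∈ P
    · have haq : (weilGraph P).Adj a q := Or.inl ⟨ha, hq⟩
      exact ⟨SimpleGraph.Walk.cons haq (SimpleGraph.Walk.cons hpq.symm SimpleGraph.Walk.nil)⟩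
    · have hap : (weilGraph P).Adj a p := Or.inr ⟨ha, hp⟩
      exact ⟨SimpleGraph.Walk.cons hap SimpleGraph.Walk.nil⟩
  exact ⟨fun a b => (key a).trans (key b).symm⟩

/-- Degrees in `K_{P,P̄}`. -/
theorem degree_weilGraph (P : Finset (Fin n)) (a : Fin n) :
    (weilGraph P).degree a = if a ∈ P then n - P.card else P.card := by
  rw [← SimpleGraph.card_neighborFinset_eq_degree, SimpleGraph.neighborFinset_eq_filter]
  by_cases ha : a ∈ P
  · rw [if_pos ha]
    have : (Finset.univ.filter fun b => (weilGraph P).Adj a b) = Pᶜ := by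
      ext b; simp [weilGraph, Separates, ha]
    rw [this, Finset.card_compl, Fintype.card_fin]
  · rw [if_neg ha]
    have : (Finset.univ.filter fun b => (weilGraph P).Adj a b) = P := by
      ext b; simp [weilGraph, Separates, ha]
    rw [this]

/-- `#edges K_{P,P̄} = |P|·(n − |P|)` — the dimension of the PEL (Weil-type) family of signature `(|P|, n − |P|)` through
the anchor (G2-DEFORM-SANITY B.4 / §D). -/
theorem card_edgeFinset_weilGraph (P : Finset (Fin n)) :
    (weilGraph P).edgeFinset.card = P.card * (n - P.card) := by
  have h := (weilGraph P).sum_degrees_eq_twice_card_edges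
  simp only [degree_weilGraph] at h
  rw [Finset.sum_ite, Finset.sum_const, Finset.sum_const, smul_eq_mul, smul_eq_mul] at h
  have h1 : (Finset.univ.filter fun a : Fin n => a ∈ P) = P := by ext a; simp
  have h2 : (Finset.univ.filter fun a : Fin n => a ∉ P) = Pᶜ := by ext a; simp
  rw [h1, h2, Finset.card_compl, Fintype.card_fin] at h
  have : 2 * (P.card * (n - P.card)) = 2 * (weilGraph P).edgeFinset.card := by
    rw [← h]; ring
  omega

/-! ## (S5) THE LOCALISATION THEOREM at the reducible point — with its NAMED hypotheses -/

/-- An object `F` at the reducible CM point `X = E₁ × ⋯ × Eₙ` with the three pieces of data the first-order argument uses;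
nothing geometric is constructed — the fields are abstract and the two hypotheses `HArr`, `HNC` say what geometry
supplies. -/
structure ReduciblePointObject (K : Type*) [Field K] (n : ℕ) where
  /-- the governing arrangement `𝒮(F)`: coordinate types `S_c ⊆ [n]` of the sub-torus translates `B_c`
  (`S_c = {i, j}` for the SR design `W = ⋃ B_ij` and every `Z_d ⊇ W + γ`, `F_d = I_{Z_d}(b)`, `F′`). -/
  types : Finset (Finset (Fin n))
  /-- `ob_F(ξ) = 0`: `F` admits a first-order deformation along `X_ξ`, `ξ ∈ H¹(T_X)`. -/
  Unobstructed : Dir K n → Prop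
  /-- the graph `𝒢_G` on `[n]` whose edges are the `G`-INVARIANT mixed pp directions `θ_ab + θ_ba`
  (`fullGraph n` for `G ⊂` translations `⋊ ⟨ι⟩`; `weilGraph P` once `J = η_P(u)` is adjoined). -/
  invGraph : SimpleGraph (Fin n)
  /-- `F` is `G`-semiregular: `σ_F` is injective on `(Ext²(F,F))^G` (plain, equivariant or twisted form). -/
  GSemiregular : Prop

namespace ReduciblePointObject

variable (F : ReduciblePointObject K n)

/-- **(H-arr) «arrangement-governed»** (G2-DEFORM-SANITY C.2): if `ob_F(ξ) = 0` then every governing branch `B_{S_c}`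
follows `ξ` to first order.  Certified ON PAPER for literal ideal sheaves `I_Z ⊗ L` (Lemma L1: `N′_Z = ⊕ ν_* N_B` and the
connecting map `N′_Z → 𝓔xt¹(I_Z, I_Z)` is an isomorphism — gs-eng-1 g2 ×2 with deform EXT-NOTE §6; Prop. K), for the
partial normalisation `F′`, for `⊠`-products and Fourier–Mukai images (eng1 (R2)–(R4), Toda 2009 Thm 1.1/4.7).
A NAMED HYPOTHESIS SHAPE, not a Lean theorem and not a Literature fact. -/
def HArr : Prop := ∀ ξ : Dir K n, F.Unobstructed ξ → ∀ S ∈ F.types, Follows S ξ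

/-- **(H-NC) «semiregularity forces the invariant pp directions»**: if `F` is `G`-semiregular then `ob_F(θ_ab + θ_ba) = 0`
for every `G`-invariant mixed pp direction.  ON PAPER: `σ_F(ob_F(ξ)) = ± ξ ⌟ ch(F)` ((S1), Buchweitz–Flenner 2003 §4 /
2008 Prop. 6.4.4), `ξ ⌟ ch(F) = 0` for pp `ξ` because `ch(F) ∈ ℚ[b]` ((S2)), and `ob_F(ξ) ∈ (Ext²)^G` for `G`-invariant
`ξ`; hence `ob_F(ξ) ∈ ker σ_F ∩ (Ext²)^G = 0`.  A NAMED HYPOTHESIS SHAPE, not a Lean theorem. -/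
def HNC : Prop := F.GSemiregular → ∀ a b : Fin n, F.invGraph.Adj a b → F.Unobstructed (ppDir a b)

/-- **(S5) LOCALISATION AT THE REDUCIBLE POINT (PROPOSITION G2-ARR), every `n`.**  Under (H-arr) and (H-NC), if the
invariant-pair graph is connected, a `G`-semiregular `F` has only TRIVIAL governing types: every `S_c` is `∅` (the
component is `X`) or `[n]` (a point).  The CM type / the group `G` only select WHICH connected graph is used
(`fullGraph_connected`, `weilGraph_connected`). -/
theorem types_trivial_of_semiregular (hArr : F.HArr) (hNC : F.HNC) (hconn : F.invGraph.Connected)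
    (hSR : F.GSemiregular) : ∀ S ∈ F.types, S = ∅ ∨ S = Finset.univ := by
  intro S hS
  refine eq_empty_or_eq_univ_of_connected hconn fun a b hab => ?_
  have hfol : Follows S (ppDir a b : Dir K n) := hArr _ (hNC hSR a b hab) S hS
  exact (follows_ppDir_iff (F.invGraph.ne_of_adj hab) S).1 hfol

/-- **Contrapositive (the verdict of record for SR-type designs, C7(a)/(S-B)).**  An arrangement-governed object with ONE
governing component of dimension strictly between `0` and `n` is NOT `G`-semiregular, for any `G` whose invariant-pair
graph is connected — every `n`, every `d`, every CM type. -/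
theorem not_semiregular_of_nontrivial_type (hArr : F.HArr) (hNC : F.HNC) (hconn : F.invGraph.Connected)
    {S : Finset (Fin n)} (hS : S ∈ F.types) (h0 : S ≠ ∅) (h1 : S ≠ Finset.univ) : ¬ F.GSemiregular :=
  fun hSR => (F.types_trivial_of_semiregular hArr hNC hconn hSR S hS).elim h0 h1

/-- SR designs (`W = ⋃_{i<j} B_ij`, `Z_d`, `F_d`, `F′`: a governing type of cardinality `2`) are not `G`-semiregular for
any `n ≥ 3` — modulo (H-arr), (H-NC) and connectedness of `𝒢_G`. -/
theorem not_semiregular_of_pair_type (hn : 3 ≤ n) (hArr : F.HArr) (hNC : F.HNC) (hconn : F.invGraph.Connected)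
    {S : Finset (Fin n)} (hS : S ∈ F.types) (hS2 : S.card = 2) : ¬ F.GSemiregular := by
  refine F.not_semiregular_of_nontrivial_type hArr hNC hconn hS ?_ ?_
  · rintro rfl; simp at hS2
  · rintro rfl
    rw [Finset.card_univ, Fintype.card_fin] at hS2
    omega

end ReduciblePointObject

end Summit.Ventures.HSemireg.ObstructionLocus
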